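import Summits.QuantumFields.BalabanUV.T4Continuum.Spine.NE1p.DressedSmallFieldFamilyCount
import Summits.QuantumFields.BalabanUV.T4Continuum.Spine.NE1p.DressedSmallFieldGeometryFaces

/-!
# T⁴ programme, spine estimate NE1′ (node O3b/H2) — THE COUNT-SPLIT ENDs OF N0s WITHOUT A GEOMETRY HYPOTHESIS: N0s's
# `attachedPart_locE_le_of_coresAt_pencil_count` ∕ `muPart_locE_le_of_coresAt_pencil_count` ∕ `attachedPart_locE_le_of_actOfLetters_count`
# ((B3) split into a per-term AMPLITUDE `hAmp` and a TABLE-BLIND COUNT `hCount`) on pv22's `tgeometry 4 N` with located numerals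
# (PART 1 of the N0s faces; PART 2 `DressedSmallFieldCoveringFamiliesFaces` = the ϱ-free and two-scale torus forms of the families END)

Cell `pub-balaban`, sub-cell `t4`, BINDER-OWNERS row NE1′ (owner lineage t4-ne1p-p1); crew seat `b2b-balaban-t4-ne1p-formalise-leaf-05`
(LEAF PROVER 05, generation 11); crew FACE row S34 ∕ DAG N29zze, PART 1 (INTENT `CLAIMS.log` 2026-08-20 l.18618, BOOKED typer R-T124 (ii);
R-T102 (i)'s invariant «every owner END with a `Geometry` socket gets its faces»; X-read X149).  ADDITIVE — imports the owner's N0s `Spine/NE1p/DressedSmallFieldFamilyCount` (⇒ N0r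
`DressedSmallFieldOnCoresSlot` ⇒ N0q ⇒ N0p ⇒ N0o ⇒ N0m v1.2; the substrate cell's `Support/SubstrateActivities`) and crew row S24
`Spine/NE1p/DressedSmallFieldGeometryFaces` (for `K₀_four`) ONLY; THEOREMS ONLY (0 `def`, 0 `def … : Prop`); nothing of N0s ∕ N0r ∕ N0q ∕
N0p ∕ N0o ∕ N0m ∕ S24–S29 ∕ the substrate ∕ row NE5 ∕ b13 restated.

WHY THIS FILE.  N0s splits (B3)'s letter budget `hM3 ⇐ hAmp ∧ hCount` (its §1 `sum_le_amp_mul_count`): the dressed table radius and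
the source window enter ONLY the per-term AMPLITUDE clause `hAmp`, the COUNT `hCount` is TABLE-BLIND — μ-free and cutoff-free BY
CONSTRUCTION.  But N0s's three count-split ENDs (§3 ∕ §3b) keep the step geometry `G : B13Resummation.Geometry D Cube` with the clauses at
`G`'s letters (`hrate : r₁ + 2·G.κ₀ + 2 ≤ R`, `hsmall : (A₀ + ϱA₁)·e^{b₅+1}·G.K₀·G.ν·G.c₁ ≤ 1`).  After S24–S29 every OTHER small-field END
has a form with NO geometry hypothesis on the tree's CONSTRUCTED torus geometry; THIS FILE wires the same for N0s §3 ∕ §3b — the S25–S29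
§2 pattern verbatim (`D := tsys 4 N`, `G := tgeometry 4 N`, all `Geometry` fields PROVED by pv22; constants LOCATED AS NUMERALS by N0o
`torus_consts` + S24 `K₀_four`: ν = 9, κ₀ = 64·log 162, c₁ = 64, K₀ = `B12TreeDecay.K₀ 64 8`; print's (2.27) `c = 5` through N0s's `hb`
at `b₅ = 5·r₁`): `attachedPart_locE_le_of_coresAt_pencil_count_torus` (cores with term-dependent polymer families along the table
pencil `h₀ + s • w`, general ϱ), `muPart_locE_le_of_coresAt_pencil_count_torus` (the source-pencil twin, general `0 < μ₀ < μ₁`) and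
`attachedPart_locE_le_of_actOfLetters_count_torus` (the substrate's slot `actOfLetters ℓ`, term index `Pol × J`).  Conclusions LITERALLY
the crew currency of S25∕S26∕S27∕S29 `4·(e·9·64·K₀(64,8)²)·A₁·e^{−r₁·torusTreeLen X₀}` and N0o's μ-part currency
`e·9·64·K₀(64,8)²·A·e^{−r₁·torusTreeLen X₀}·μ₀/(μ₁ − μ₀)` (= S29 `muPart_locE_le_of_actOfLetters_torus`'s).  The ϱ-free forms and the
families END (N0s §4, a SECOND socket `Gk`) are PART 2's.
WHAT STAYS DISPLAYED (binders, by name; NOTHING instantiated on Bałaban's densities): the room `hroom`; the operator conditions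
`hm`∕`hN`∕`hq` (rows NE2∕NE3's Gaussian data, row NE5's factor-letter blocks, the substrate's SUPPLIED letters); the class radii `hO`∕`hH`;
(B1b)'s residue `terms`∕`emb`∕`hscale`∕`hact`; (B3-amp) `hAmp` — THE place where the dressed table radius `‖h₀‖ + ϱ‖w‖` ∕ `‖h₀‖ + μ₁‖v‖`
enters — and (B3-count) `hCount` against ABSTRACT table-blind majorants `maj` (= GAPS G-ne9p2-5 read in the letter currency, UNPRINTED,
shared with NE9; BINDERS, never cite-tagged); `hA₀`∕`hA₁`∕`hA`, `hr₁`, N0m's `hϱ`∕`hϱA`; and the located clauses «κ large»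
`r₁ + 2·(64·log 162) + 2 ≤ R`, «ε₁ small» `(A₀ + ϱA₁)·e^{5r₁+1}·K₀(64,8)·9·64 ≤ 1` ∕ `A·(…) ≤ 1` ((B5): SHAPES consumed BY NAME; their
standing against print's NUMBERS is untouched).  (B4) is discharged BY NAME on pv22's CONSTRUCTED torus geometry; the identification of
`tsys 4 N` ∕ `torusTreeLen` with Bałaban's 𝐃_{k+1} ∕ d_{k+1} is pv22's READING (DIVERGENCE D-pv22.3), not asserted here — statements about
typed SHAPES; no new inequality; no wall item moves; the wall line (v1.7 of record, T4-DAG v43) does NOT move; R-t4r2-Q2 NOT met thereby.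
WORDING OF RECORD (typer R-T124 (ii)): S29's wording (R-T113 (iii-d)(g)) + «N0s's count-split and families ENDs re-socketed BY NAME;
(B3-count) for the 𝐃-step is b13's PROVED (2.29) on pv22's CONSTRUCTED `tgeometry 4 M` — whether print's δ, κ, α₆ meet the located numerals is
NOT asserted; WHICH `M` is the scale-k torus is pv22's READING (D-pv22.3)» + rider «`foot`∕`hmono` are DISPLAYED binders — the L-refinement
between the two tori is NOT constructed here» (the two-scale items are PART 2's).
HONEST FRAMING.  Kernel bookkeeping; the cores ∕ letters ∕ `actOfLetters` are the cell's typed FORMAT of (2.14) and the substrate's slot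
of record, NOT Bałaban's functions; printed loci ([Balaban1988RGII] (2.14) p. 15, (2.18) p. 16, p. 17 (order of resummation), (1.26)
p. 8, (2.27)∕(2.29) p. 18, (2.38) p. 20; [Balaban1987RGI] p. 257) are TYPE ∕ CONTEXT through the imported [cite]-tagged Literature
modules, re-asserted nowhere; ABSOLUTE RULE honoured ([folklore] kernel lemmas only).  NE1′ ⇐ the named binders — NOT printed, NOT
proved; 0 leaves instantiated on Bałaban's densities; spine PROVED 0∕9; count 9 unchanged.  Rung (B)+1 on ONE finite four-torus — NOT
infinite volume, NOT a mass gap, NOT OS on ℝ⁴, NOT Clay.  HONEST DEPENDENCY: continuum YM on T⁴ ⇐ BetaPertH ∧ nine spine estimates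
(0/9 proved); BetaPertH ⇐ (D1) ∧ (D4) ∧ CAP+tail; G-an2-4 gates asym, D1 and NE2/3/4.
-/
noncomputable section

namespace Summit.QuantumFields.BalabanUV.T4Continuum.NE1p.DressedSmallFieldFamilyCountFaces

open Metric Set Complex MeasureTheory
open scoped BigOperators
open Literature.MathematicalPhysics.QuantumFieldTheory.Balaban1983to89.T4OutputRate (Carriers)
open Literature.MathematicalPhysics.QuantumFieldTheory.Balaban1983to89.B13Resummation (locE)
open Literature.MathematicalPhysics.QuantumFieldTheory.Balaban1983to89.TreeLengthTorus (tsys torusTreeLen)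
open Literature.MathematicalPhysics.QuantumFieldTheory.Balaban1983to89.TreeLengthTorusGeometry (TTouch tgeometry)
open Literature.MathematicalPhysics.QuantumFieldTheory.Balaban1983to89.B12TreeDecay (K₀)
open Summit.QuantumFields.BalabanUV.T4Continuum.B13HistMeasurable (MeasPotFrame B13HistM)
open Summit.QuantumFields.BalabanUV.T4Continuum.B13TermParamGaussianBi (BiCore)
open Summit.QuantumFields.BalabanUV.T4Continuum.SubstrateActivities (CoreLetters coreOf actOfLetters)
open Summit.QuantumFields.BalabanUV.T4Continuum.NE1p.DressedSmallFieldFamilyCount (attachedPart_locE_le_of_coresAt_pencil_count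
  muPart_locE_le_of_coresAt_pencil_count attachedPart_locE_le_of_actOfLetters_count)
open Summit.QuantumFields.BalabanUV.T4Continuum.NE1p.DressedSmallFieldGeometry (torus_consts)
open Summit.QuantumFields.BalabanUV.T4Continuum.NE1p.DressedSmallFieldGeometryFaces (K₀_four)

/-! ## ON THE TORUS OF THE PAPERS (pv22's `tgeometry 4 N`): NO geometry hypothesis, clauses LOCATED AS NUMERALS (S24–S29 §2 pattern:
ν = 9, κ₀ = 64·log 162, c₁ = 64, K₀ = `B12TreeDecay.K₀ 64 8`, print's (2.27) `c = 5`, `b₅ = 5·r₁`) -/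

section Torus

variable {N : ℕ} [NeZero N]

/-! ### §1 Cores with term-dependent polymer families (abstract term index `ι`) -/

section Dep

variable {C : Carriers} {P : MeasPotFrame C} {Op : Type*} [NormedAddCommGroup Op] [NormedSpace ℂ Op] {ι : Type*}
  {𝒴 : ℕ → ι → Type*} {dom : ∀ k i, 𝒴 k i → C.Dom} {β : ℕ → ι → Type*} [∀ k i, MeasurableSpace (β k i)]
  {α : ℕ → ι → Type*} [∀ k i, NormedAddCommGroup (α k i)] [∀ k i, InnerProductSpace ℝ (α k i)]
  [∀ k i, FiniteDimensional ℝ (α k i)] [∀ k i, MeasurableSpace (α k i)] [∀ k i, BorelSpace (α k i)]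

open Classical in
/-- **THE TERM-DEPENDENT CORES END ALONG `h₀ + s • w` ON THE TORUS, (B3) SPLIT INTO AMPLITUDE AND COUNT — NO GEOMETRY HYPOTHESIS**
(kernel; N0s §3 `attachedPart_locE_le_of_coresAt_pencil_count` ONCE at `D := tsys 4 N`, `G := tgeometry 4 N`, constants located): the
operator letters `hm`∕`hN`∕`hq`, room, pencil radii `hO`∕`hH`, indexing `hact`, the located clauses, N0m's `hϱ`∕`hϱA`, the per-term
AMPLITUDE `hAmp` against table-blind majorants `maj` and the COUNT `hCount` at rate `e^{−R·torusTreeLen Z}`: the attached part on a torus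
domain `X₀` is `≤ 4·(e·9·64·K₀(64,8)²)·A₁·e^{−r₁·torusTreeLen X₀}` — the crew currency of S25–S29. [folklore] -/
theorem attachedPart_locE_le_of_coresAt_pencil_count_torus {W : Set (ℕ → ℝ)}
    {ctr : ℕ → (ℕ → ℝ) → C.BgB → Op × B13HistM P} {ROp RHist R' : ℕ → ℝ}
    (𝔊 : ∀ k i, C.Dom → BiCore P (dom k i) Op (β k i) (α k i)) {mq bq N₀ : ℕ → ι → C.Dom → ℝ} (hroom : ∀ k, ROp k < R' k)
    (hm : ∀ k, ∀ g ∈ W, ∀ (U : C.BgB) (X : C.Dom), C.scale X = k → ∀ i, 0 < mq k i X)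
    (hN : ∀ k, ∀ g ∈ W, ∀ (U : C.BgB) (X : C.Dom), C.scale X = k → ∀ i,
      (∀ o ∈ ball (ctr k g U).1 (R' k), AEStronglyMeasurable ((𝔊 k i X).N o) (𝔊 k i X).lam) ∧
      (∀ p, DifferentiableOn ℂ (fun o => (𝔊 k i X).N o p) (ball (ctr k g U).1 (R' k))) ∧
      (∀ o ∈ ball (ctr k g U).1 (R' k), ∀ p, ‖(𝔊 k i X).N o p‖ ≤ N₀ k i X))
    (hq : ∀ k, ∀ g ∈ W, ∀ (U : C.BgB) (X : C.Dom), C.scale X = k → ∀ i,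
      (∀ o ∈ ball (ctr k g U).1 (R' k),
        AEStronglyMeasurable (Function.uncurry ((𝔊 k i X).q o)) ((𝔊 k i X).lam.prod volume)) ∧
      (∀ p v, DifferentiableOn ℂ (fun o => (𝔊 k i X).q o p v) (ball (ctr k g U).1 (R' k))) ∧
      (∀ o ∈ ball (ctr k g U).1 (R' k), ∀ p v, mq k i X * ‖v‖ ^ 2 - bq k i X ≤ ((𝔊 k i X).q o p v).re))
    {k : ℕ} {g : ℕ → ℝ} (hg : g ∈ W) {U : C.BgB} {o : Op} {h₀ w : B13HistM P} {ϱ : ℝ}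
    (hO : ‖o - (ctr k g U).1‖ ≤ ROp k) (hH : ‖h₀ - (ctr k g U).2‖ + ϱ * ‖w‖ ≤ RHist k)
    {emb : (tsys 4 N).Dom → C.Dom} (hscale : ∀ Z, C.scale (emb Z) = k) {terms : (tsys 4 N).Dom → Finset ι}
    {act : ℂ → (tsys 4 N).Dom → ℂ}
    (hact : ∀ s ∈ ball (0 : ℂ) ϱ, ∀ Z, act s Z = ∑ i ∈ terms Z, (𝔊 k i (emb Z)).termAt o (h₀ + s • w))
    {A₀ A₁ R r₁ : ℝ} (X₀ : (tsys 4 N).Dom) (hA₀ : 0 ≤ A₀) (hA₁ : 0 ≤ A₁) (hr₁ : 0 ≤ r₁)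
    (hrate : r₁ + 2 * (64 * Real.log 162) + 2 ≤ R)
    (hsmall : (A₀ + ϱ * A₁) * Real.exp (5 * r₁ + 1) * K₀ 64 8 * 9 * 64 ≤ 1) (maj : (tsys 4 N).Dom → ι → ℝ)
    (hAmp : ∀ Z : (tsys 4 N).Dom, Z.1 ⊆ X₀.1 → ∀ i ∈ terms Z,
      (𝔊 k i (emb Z)).lam.real univ * ((𝔊 k i (emb Z)).wB * N₀ k i (emb Z) * Real.exp (bq k i (emb Z))) *
          (Real.pi / (mq k i (emb Z) / 2)) ^ (Module.finrank ℝ (α k i) / 2 : ℝ) *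
        Real.exp ((𝔊 k i (emb Z)).N₁ * (‖h₀‖ + ϱ * ‖w‖)) ≤ (A₀ + ϱ * A₁) * maj Z i)
    (hCount : ∀ Z : (tsys 4 N).Dom, Z.1 ⊆ X₀.1 → ∑ i ∈ terms Z, maj Z i ≤ Real.exp (-(R * torusTreeLen Z.1)))
    (hϱ : 2 ≤ ϱ) (hϱA : A₀ ≤ ϱ * A₁) :
    ‖locE (TTouch (d := 4) (N := N)) (fun Z : (tsys 4 N).Dom => Z.1) (act 1) X₀.1 -
        locE (TTouch (d := 4) (N := N)) (fun Z : (tsys 4 N).Dom => Z.1) (act 0) X₀.1‖ ≤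
      4 * (Real.exp 1 * 9 * 64 * K₀ 64 8 ^ 2) * A₁ * Real.exp (-(r₁ * torusTreeLen X₀.1)) := by
  obtain ⟨hν, hκ₀, hc⟩ := torus_consts N
  have hK₀ := K₀_four (N := N)
  have h := attachedPart_locE_le_of_coresAt_pencil_count (tsys 4 N) (tgeometry 4 N) 𝔊 hroom hm hN hq hg hO hH hscale hact
    (R := R) (b₅ := 5 * r₁) (X₀ := X₀) hA₀ hA₁ hr₁ (le_of_eq (by ring)) (by rw [hκ₀]; exact hrate)
    (by rw [hK₀, hν, hc]; exact hsmall) maj hAmp hCount hϱ hϱA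
  rw [hν, hc, hK₀] at h
  exact h

open Classical in
/-- **THE μ-PART (SOURCE PENCIL `h₀ + s • v`, `‖s‖ < μ₁`) ON THE TORUS, (B3) SPLIT INTO AMPLITUDE AND COUNT — NO GEOMETRY HYPOTHESIS**
(kernel; N0s §3's `muPart_locE_le_of_coresAt_pencil_count` ONCE at `tgeometry 4 N`, constants located): class radius `hH` at `μ₁`,
located clauses at the constant `A`, amplitude `hAmp` at `A` and the table radius `‖h₀‖ + μ₁‖v‖`, table-blind count `hCount`; for
`0 < μ₀ < μ₁`, `‖sμ‖ ≤ μ₀` the μ-part on a torus domain `X₀` is `≤ e·9·64·K₀(64,8)²·A·e^{−r₁·torusTreeLen X₀}·μ₀/(μ₁ − μ₀)` — N0o's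
`muPart_locE_le_torus` ∕ S29's `muPart_locE_le_of_actOfLetters_torus` currency. [folklore] -/
theorem muPart_locE_le_of_coresAt_pencil_count_torus {W : Set (ℕ → ℝ)}
    {ctr : ℕ → (ℕ → ℝ) → C.BgB → Op × B13HistM P} {ROp RHist R' : ℕ → ℝ}
    (𝔊 : ∀ k i, C.Dom → BiCore P (dom k i) Op (β k i) (α k i)) {mq bq N₀ : ℕ → ι → C.Dom → ℝ} (hroom : ∀ k, ROp k < R' k)
    (hm : ∀ k, ∀ g ∈ W, ∀ (U : C.BgB) (X : C.Dom), C.scale X = k → ∀ i, 0 < mq k i X)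
    (hN : ∀ k, ∀ g ∈ W, ∀ (U : C.BgB) (X : C.Dom), C.scale X = k → ∀ i,
      (∀ o ∈ ball (ctr k g U).1 (R' k), AEStronglyMeasurable ((𝔊 k i X).N o) (𝔊 k i X).lam) ∧
      (∀ p, DifferentiableOn ℂ (fun o => (𝔊 k i X).N o p) (ball (ctr k g U).1 (R' k))) ∧
      (∀ o ∈ ball (ctr k g U).1 (R' k), ∀ p, ‖(𝔊 k i X).N o p‖ ≤ N₀ k i X))
    (hq : ∀ k, ∀ g ∈ W, ∀ (U : C.BgB) (X : C.Dom), C.scale X = k → ∀ i,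
      (∀ o ∈ ball (ctr k g U).1 (R' k),
        AEStronglyMeasurable (Function.uncurry ((𝔊 k i X).q o)) ((𝔊 k i X).lam.prod volume)) ∧
      (∀ p v, DifferentiableOn ℂ (fun o => (𝔊 k i X).q o p v) (ball (ctr k g U).1 (R' k))) ∧
      (∀ o ∈ ball (ctr k g U).1 (R' k), ∀ p v, mq k i X * ‖v‖ ^ 2 - bq k i X ≤ ((𝔊 k i X).q o p v).re))
    {k : ℕ} {g : ℕ → ℝ} (hg : g ∈ W) {U : C.BgB} {o : Op} {h₀ v : B13HistM P} {μ₁ : ℝ}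
    (hO : ‖o - (ctr k g U).1‖ ≤ ROp k) (hH : ‖h₀ - (ctr k g U).2‖ + μ₁ * ‖v‖ ≤ RHist k)
    {emb : (tsys 4 N).Dom → C.Dom} (hscale : ∀ Z, C.scale (emb Z) = k) {terms : (tsys 4 N).Dom → Finset ι}
    {act : ℂ → (tsys 4 N).Dom → ℂ}
    (hact : ∀ s ∈ ball (0 : ℂ) μ₁, ∀ Z, act s Z = ∑ i ∈ terms Z, (𝔊 k i (emb Z)).termAt o (h₀ + s • v))
    {A R r₁ μ₀ : ℝ} (X₀ : (tsys 4 N).Dom) {sμ : ℂ} (hA : 0 ≤ A) (hr₁ : 0 ≤ r₁)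
    (hrate : r₁ + 2 * (64 * Real.log 162) + 2 ≤ R) (hsmall : A * Real.exp (5 * r₁ + 1) * K₀ 64 8 * 9 * 64 ≤ 1)
    (maj : (tsys 4 N).Dom → ι → ℝ)
    (hAmp : ∀ Z : (tsys 4 N).Dom, Z.1 ⊆ X₀.1 → ∀ i ∈ terms Z,
      (𝔊 k i (emb Z)).lam.real univ * ((𝔊 k i (emb Z)).wB * N₀ k i (emb Z) * Real.exp (bq k i (emb Z))) *
          (Real.pi / (mq k i (emb Z) / 2)) ^ (Module.finrank ℝ (α k i) / 2 : ℝ) *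
        Real.exp ((𝔊 k i (emb Z)).N₁ * (‖h₀‖ + μ₁ * ‖v‖)) ≤ A * maj Z i)
    (hCount : ∀ Z : (tsys 4 N).Dom, Z.1 ⊆ X₀.1 → ∑ i ∈ terms Z, maj Z i ≤ Real.exp (-(R * torusTreeLen Z.1)))
    (h0 : 0 < μ₀) (h01 : μ₀ < μ₁) (hμ : ‖sμ‖ ≤ μ₀) :
    ‖locE (TTouch (d := 4) (N := N)) (fun Z : (tsys 4 N).Dom => Z.1) (act sμ) X₀.1 -
        locE (TTouch (d := 4) (N := N)) (fun Z : (tsys 4 N).Dom => Z.1) (act 0) X₀.1‖ ≤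
      Real.exp 1 * 9 * 64 * K₀ 64 8 ^ 2 * A * Real.exp (-(r₁ * torusTreeLen X₀.1)) * (μ₀ / (μ₁ - μ₀)) := by
  obtain ⟨hν, hκ₀, hc⟩ := torus_consts N
  have hK₀ := K₀_four (N := N)
  have h := muPart_locE_le_of_coresAt_pencil_count (tsys 4 N) (tgeometry 4 N) 𝔊 hroom hm hN hq hg hO hH hscale hact
    (R := R) (b₅ := 5 * r₁) (X₀ := X₀) (sμ := sμ) hA hr₁ (le_of_eq (by ring)) (by rw [hκ₀]; exact hrate)
    (by rw [hK₀, hν, hc]; exact hsmall) maj hAmp hCount h0 h01 hμ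
  rw [hν, hc, hK₀] at h
  exact h

end Dep

/-! ### §2 The substrate's slot `actOfLetters ℓ` (term index `Pol × J`) -/

section Slot

variable {C : Carriers} (P : MeasPotFrame C) (Op : Type*) [NormedAddCommGroup Op] [NormedSpace ℂ Op] {Pol J : Type*}
  (𝒴 : Pol → J → Type) [∀ Z j, Fintype (𝒴 Z j)] (dom : ∀ Z j, 𝒴 Z j → C.Dom)
  (Jc : Pol → J → Type) [∀ Z j, Fintype (Jc Z j)]
  (V : Pol → J → Type) [∀ Z j, NormedAddCommGroup (V Z j)] [∀ Z j, InnerProductSpace ℝ (V Z j)]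
  [∀ Z j, MeasurableSpace (V Z j)] [∀ Z j, BorelSpace (V Z j)] [∀ Z j, FiniteDimensional ℝ (V Z j)]

open Classical in
/-- **THE SLOT END ON THE TORUS, (B3) SPLIT INTO AMPLITUDE AND COUNT — NO GEOMETRY HYPOTHESIS** (kernel; N0s §3b
`attachedPart_locE_le_of_actOfLetters_count` ONCE at `tgeometry 4 N`, constants located): for the substrate's letter families `ℓ Z j`
with their operator conditions, class radii, (B1b)'s residue `terms`∕`emb`∕`hscale`, the located clauses, N0m's `hϱ`∕`hϱA`, the
per-term AMPLITUDE `hAmp` of the substrate's letters against table-blind majorants `maj Z p` and the μ-free COUNT `hCount`: the attached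
part of `Σ_{p ∈ terms Z} actOfLetters ℓ p.1 p.2 o (h₀ + w)` against `… o h₀` on a torus domain `X₀` is
`≤ 4·(e·9·64·K₀(64,8)²)·A₁·e^{−r₁·torusTreeLen X₀}`. [folklore] -/
theorem attachedPart_locE_le_of_actOfLetters_count_torus {W : Set (ℕ → ℝ)}
    {ctr : ℕ → (ℕ → ℝ) → C.BgB → Op × B13HistM P} {ROp RHist R' : ℕ → ℝ} (ℓ : ∀ Z j, CoreLetters P Op 𝒴 dom Jc V Z j)
    {mq bq N₀ : ℕ → Pol × J → C.Dom → ℝ} (hroom : ∀ k, ROp k < R' k)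
    (hm : ∀ k, ∀ g ∈ W, ∀ (U : C.BgB) (X : C.Dom), C.scale X = k → ∀ p, 0 < mq k p X)
    (hN : ∀ k, ∀ g ∈ W, ∀ (U : C.BgB) (X : C.Dom), C.scale X = k → ∀ p : Pol × J,
      (∀ o ∈ ball (ctr k g U).1 (R' k),
        AEStronglyMeasurable ((ℓ p.1 p.2).N o) (coreOf P Op 𝒴 dom Jc V ℓ p.1 p.2).lam) ∧
      (∀ a, DifferentiableOn ℂ (fun o => (ℓ p.1 p.2).N o a) (ball (ctr k g U).1 (R' k))) ∧
      (∀ o ∈ ball (ctr k g U).1 (R' k), ∀ a, ‖(ℓ p.1 p.2).N o a‖ ≤ N₀ k p X))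
    (hq : ∀ k, ∀ g ∈ W, ∀ (U : C.BgB) (X : C.Dom), C.scale X = k → ∀ p : Pol × J,
      (∀ o ∈ ball (ctr k g U).1 (R' k),
        AEStronglyMeasurable (Function.uncurry ((ℓ p.1 p.2).q o))
          ((coreOf P Op 𝒴 dom Jc V ℓ p.1 p.2).lam.prod volume)) ∧
      (∀ a v, DifferentiableOn ℂ (fun o => (ℓ p.1 p.2).q o a v) (ball (ctr k g U).1 (R' k))) ∧
      (∀ o ∈ ball (ctr k g U).1 (R' k), ∀ a v, mq k p X * ‖v‖ ^ 2 - bq k p X ≤ ((ℓ p.1 p.2).q o a v).re))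
    {k : ℕ} {g : ℕ → ℝ} (hg : g ∈ W) {U : C.BgB} {o : Op} {h₀ w : B13HistM P} {ϱ : ℝ}
    (hO : ‖o - (ctr k g U).1‖ ≤ ROp k) (hH : ‖h₀ - (ctr k g U).2‖ + ϱ * ‖w‖ ≤ RHist k)
    {emb : (tsys 4 N).Dom → C.Dom} (hscale : ∀ Z, C.scale (emb Z) = k) (terms : (tsys 4 N).Dom → Finset (Pol × J))
    {A₀ A₁ R r₁ : ℝ} (X₀ : (tsys 4 N).Dom) (hA₀ : 0 ≤ A₀) (hA₁ : 0 ≤ A₁) (hr₁ : 0 ≤ r₁)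
    (hrate : r₁ + 2 * (64 * Real.log 162) + 2 ≤ R)
    (hsmall : (A₀ + ϱ * A₁) * Real.exp (5 * r₁ + 1) * K₀ 64 8 * 9 * 64 ≤ 1) (maj : (tsys 4 N).Dom → Pol × J → ℝ)
    (hAmp : ∀ Z : (tsys 4 N).Dom, Z.1 ⊆ X₀.1 → ∀ p ∈ terms Z,
      (coreOf P Op 𝒴 dom Jc V ℓ p.1 p.2).lam.real univ *
          ((coreOf P Op 𝒴 dom Jc V ℓ p.1 p.2).wB * N₀ k p (emb Z) * Real.exp (bq k p (emb Z))) *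
          (Real.pi / (mq k p (emb Z) / 2)) ^ (Module.finrank ℝ (V p.1 p.2) / 2 : ℝ) *
        Real.exp ((coreOf P Op 𝒴 dom Jc V ℓ p.1 p.2).N₁ * (‖h₀‖ + ϱ * ‖w‖)) ≤ (A₀ + ϱ * A₁) * maj Z p)
    (hCount : ∀ Z : (tsys 4 N).Dom, Z.1 ⊆ X₀.1 → ∑ p ∈ terms Z, maj Z p ≤ Real.exp (-(R * torusTreeLen Z.1)))
    (hϱ : 2 ≤ ϱ) (hϱA : A₀ ≤ ϱ * A₁) :
    ‖locE (TTouch (d := 4) (N := N)) (fun Z : (tsys 4 N).Dom => Z.1)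
          (fun Z => ∑ p ∈ terms Z, actOfLetters P Op 𝒴 dom Jc V ℓ p.1 p.2 o (h₀ + w)) X₀.1 -
        locE (TTouch (d := 4) (N := N)) (fun Z : (tsys 4 N).Dom => Z.1)
          (fun Z => ∑ p ∈ terms Z, actOfLetters P Op 𝒴 dom Jc V ℓ p.1 p.2 o h₀) X₀.1‖ ≤
      4 * (Real.exp 1 * 9 * 64 * K₀ 64 8 ^ 2) * A₁ * Real.exp (-(r₁ * torusTreeLen X₀.1)) := by
  obtain ⟨hν, hκ₀, hc⟩ := torus_consts N
  have hK₀ := K₀_four (N := N)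
  have h := attachedPart_locE_le_of_actOfLetters_count P Op 𝒴 dom Jc V (tsys 4 N) (tgeometry 4 N) ℓ hroom hm hN hq hg hO hH
    hscale terms (R := R) (b₅ := 5 * r₁) (X₀ := X₀) hA₀ hA₁ hr₁ (le_of_eq (by ring)) (by rw [hκ₀]; exact hrate)
    (by rw [hK₀, hν, hc]; exact hsmall) maj hAmp hCount hϱ hϱA
  rw [hν, hc, hK₀] at h
  exact h

end Slot

end Torus

end Summit.QuantumFields.BalabanUV.T4Continuum.NE1p.DressedSmallFieldFamilyCountFaces

end
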